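import Summits.QuantumFields.BalabanUV.Beta.FP.PerfectKernelSymm
import Summits.QuantumFields.BalabanUV.Beta.FP.TowerFTransportRow
import Summits.QuantumFields.BalabanUV.Beta.FP.TowerNParityRowsEven

/-!
# `BalabanUV.Beta.FP.TowerNKernelIndexSymmetry` — road «FP», binder row D1, ROUTE T, the (H5-F) option (3a) (road FINDING FP-70, journal [D1P3-G62-A2]): **THE RECORD's
# COMPOSITE ONE-LOOP KERNEL OBEYS THE PRINTED SYMMETRY (5.8) AT EVERY STOREY** — `IndexSymmetric (hessKer (AN Rt j) (VN Rt P j) (WN Rt P j))`, hence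
# `IndexSymmetric (TshotOf Lc (JcComp …) (m+2))`, BY NAME from leaf-02's `PerfectKernelSymm.hessKer_swap` and the record's covariance ∕ swap letters

WHY (road A-2 = FINDING FP-70; an2 g85 W-2 §10).  Under option (3a) the END's dressing-invariance junction `hWT j` follows (road `DressedEntryWardInvariance` v2,
`dressedEntry_eq_of_bgrad_of_wardTransversal`) from the gauge letter `hgauge j` and TWO printed predicates of the dressed table `𝒯_j`: the Ward identity (5.9)
`WardTransversal (flipK 𝒯_j)` and the symmetry (5.8) `IndexSymmetric 𝒯_j`.  At the anchor `𝒯_0 = TshotOf … 1` both are tree theorems (road `TowerFAnchorWardRecord`); for `j ≥ 1`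
the table is the record's COMPOSITE one-loop kernel `𝒯_j = hessKer (AN Rt j) (VN Rt P j) (WN Rt P j)` (= `TshotOf Lc (JcComp …) (j+1)`, an2 (L2′) `TshotOf_JcComp_succ_succ`), whose Ward
identity is NOT in the tree (DISPLAYED as `hW𝒯 j`; by value road R-FP-62-WARD (W2) ∕ TEL2 CONTROL C10) but whose index symmetry IS [folklore]: leaf-02-g4's `hessKer_swap` (leg decaying
and coarse-invariant, first-order family a coarse-covariant vertex family, second-order family coarse-covariant and swap-symmetric) fed the record's letters BY NAME — an2
`NVertexSectors.decays_AN`, `NVertexParities.vertexFamilies_VN_WN`, road g58 `TowerFTransportRow.shiftK_AN_smul ∕ VN_translate ∕ WN_translate`, road `TowerNParityRowsEven.WN_swap`.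
THIS FILE types it, so that under (3a) the END displays ONE table letter per storey j ≥ 1 (`hW𝒯 j`), not two.

WHAT ([folklore] composition BY NAME; no `def`, no `def … : Prop`, nothing cited, 0 sorry): §1 `shiftK_neg_AN_smul` (the leg's coarse invariance in `hessKer_swap`'s spelling),
**`hessKer_AN_swap`** (`hessKer (AN R j) (VN R P j) (WN R P j) a b t = (same) b a (−t)`), **`indexSymmetric_hessKer_AN`**; §2 **`indexSymmetric_TshotOf_JcComp_succ_succ`**
(`IndexSymmetric (TshotOf Lc (JcComp hLc N cΛ cB R P) (m+2))`), and with road `TowerFAnchorWardRecord`'s anchor case in mind the uniform statement **`indexSymmetric_TshotOf_JcComp_succ`**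
is NOT claimed here for `m+1 = 1` (that case is `indexSymmetric_TbalOf_JsB12CombShSym` through `TshotOf_JcComp_one`, a different import chain — kept in the anchor file).
WHAT THIS IS NOT: not the Ward identity of the composite kernel (DISPLAYED where used); nothing of Bałaban's asserted, valued or discharged; 0 estimates; 0∕4 row-D1 binders
(hW, hR, D1Tel, D1Rep); NOT (C1), NOT (T-ID), NOT D1, NEVER «G-an2-4 closed», NOT BetaPertH, NOT continuum, NOT Clay.

HONEST DEPENDENCY (page 1, mandatory): continuum YM on T⁴ ⇐ BetaPertH ∧ nine spine estimates (0/9 proved); BetaPertH ⇐ (D1) ∧ (D4) ∧ CAP+tail;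
G-an2-4 gates asym, D1 and NE2/3/4.  HONEST FRAMING (cell contract, verbatim): «discharging `BetaPertH` makes Bałaban's UV stability UNCONDITIONAL —
a real constructive-QFT result; it is NOT the continuum limit and NOT the Clay problem.»  ABSOLUTE RULE (cell charter, verbatim): «No internally-minted
statement may enter as a cited fact. Every hypothesis is either kernel-proved in this package or a verbatim quotation of a PUBLISHED theorem with page
reference. The manuscript(s) under audit are NOT citable for their own disputed steps — they are the thing under adjudication; programme-internal
(2001/route/tribunal) claims are never citable.»  Road «FP» OWNER, b2b-balaban-beta-d1-p3 gen 62, 2026-08-30.  No existing file touched.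
-/

noncomputable section

open scoped BigOperators

namespace Summit.QuantumFields.BalabanUV.Beta.FP.TowerNKernelIndexSymmetry

open Literature.MathematicalPhysics.QuantumFieldTheory.Balaban1983to89
open Literature.MathematicalPhysics.QuantumFieldTheory.Balaban1983to89.Beta
open ExpKernelCalculus (Site MKer Decays BiLoc VertexFamily hessKer shiftK)
open OneStepResolventKernel (Fib)
open OneStepKernelFamily (TshotOf)
open PolarizationSign (IndexSymmetric)
open Summit.QuantumFields.BalabanUV.Beta.TameKernelCalculus (decays_of_le biLoc_of_le)
open Summit.QuantumFields.BalabanUV.Beta.CompositeOneShotJetData (Roots Pins AN VN WN JcComp TshotOf_JcComp_succ_succ)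
open Summit.QuantumFields.BalabanUV.Beta.NVertexSectors (decays_AN)
open Summit.QuantumFields.BalabanUV.Beta.NVertexParities (vertexFamilies_VN_WN)
open Summit.QuantumFields.BalabanUV.Beta.FP.PerfectKernelSymm (hessKer_swap)
open Summit.QuantumFields.BalabanUV.Beta.FP.TowerFTransportRow (shiftK_AN_smul VN_translate WN_translate)
open Summit.QuantumFields.BalabanUV.Beta.FP.TowerNParityRowsEven (WN_swap)

variable {Lc : ℕ} [NeZero Lc] (R : Roots Lc) (P : Pins)

/-! ## §1 The composite one-loop kernel of the record is index-symmetric at every storey -/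

/-- [folklore] the record chart's coarse invariance in `hessKer_swap`'s spelling: `shiftK (−(Lc^(j+1)•t)) (AN R j) = AN R j` (road g58 `shiftK_AN_smul` at `−t`). -/
theorem shiftK_neg_AN_smul (j : ℕ) (t : Fin (3 + 1) → ℤ) :
    shiftK (-((((Lc ^ (j + 1) : ℕ) : ℤ)) • t)) (AN R j) = AN R j := by
  have h := shiftK_AN_smul Lc R j (-t)
  rwa [smul_neg] at h

/-- [folklore] **`hessKer_AN_swap` — TRANSPOSITION SYMMETRY OF THE RECORD's COMPOSITE ONE-LOOP KERNEL** at storey `j`: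
`hessKer (AN R j) (VN R P j) (WN R P j) a b t = hessKer (AN R j) (VN R P j) (WN R P j) b a (−t)` — leaf-02's `hessKer_swap` at the common rate `min δ_A δ_V`, fed an2's
`decays_AN ∕ vertexFamilies_VN_WN` and the record's covariance ∕ swap letters `shiftK_AN_smul ∕ VN_translate ∕ WN_translate ∕ WN_swap`. -/
theorem hessKer_AN_swap (j : ℕ) (a b : Fin (3 + 1)) (t : Fin (3 + 1) → ℤ) :
    hessKer (AN R j) (VN R P j) (WN R P j) a b t = hessKer (AN R j) (VN R P j) (WN R P j) b a (-t) := by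
  obtain ⟨δA, CA, hδA, -, hA⟩ := decays_AN R j
  obtain ⟨Cv, Cw, δv, hδv, hV, -⟩ := vertexFamilies_VN_WN R P j
  have hm : 0 < min δA δv := lt_min hδA hδv
  have hA' := decays_of_le hA (min_le_left δA δv)
  have hV' : VertexFamily (VN R P j) (Lc ^ (j + 1)) (|Cv|) (min δA δv) := fun μ y => biLoc_of_le (hV μ y) (min_le_right _ _)
  exact hessKer_swap hA' hm (fun t => shiftK_neg_AN_smul R j t) hV' (fun μ y s => VN_translate Lc R P j μ y s)
    (fun μ y ν y' s => WN_translate Lc R P j μ y ν y' s) (fun μ y ν y' => (WN_swap R P j μ y ν y').symm) a b t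

/-- [folklore] **`indexSymmetric_hessKer_AN` — THE PRINTED PREDICATE (5.8) FOR THE RECORD's COMPOSITE ONE-LOOP KERNEL**, every storey:
`IndexSymmetric (hessKer (AN R j) (VN R P j) (WN R P j))` (`PolarizationSign.IndexSymmetric P := ∀ μ ν x, P μ ν x = P ν μ (−x)`). -/
theorem indexSymmetric_hessKer_AN (j : ℕ) : IndexSymmetric (hessKer (AN R j) (VN R P j) (WN R P j)) :=
  fun μ ν x => hessKer_AN_swap R P j μ ν x

/-! ## §2 … hence for the one-shot composite family of the record from depth 2 on -/

/-- [folklore] **`indexSymmetric_TshotOf_JcComp_succ_succ`** — `IndexSymmetric (TshotOf Lc (JcComp hLc N cΛ cB R P) (m+2))` (an2 (L2′) `TshotOf_JcComp_succ_succ` + §1). -/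
theorem indexSymmetric_TshotOf_JcComp_succ_succ (hLc : Odd Lc) (N : ℕ) (cΛ cB : ℝ) (m : ℕ) :
    IndexSymmetric (TshotOf Lc (JcComp hLc N cΛ cB R P) (m + 2)) := by
  rw [TshotOf_JcComp_succ_succ hLc N cΛ cB R P m]
  exact indexSymmetric_hessKer_AN R P (m + 1)

end Summit.QuantumFields.BalabanUV.Beta.FP.TowerNKernelIndexSymmetry

end
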